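/-
Copyright (c) 2026 the pub-hodgecm-mathlib formalisation cell (harness21).  Prover seat hodgecm-mathlib-K2E4-p11 (g10) on the S4 valve (dealer K2E2-plan (g8), S4-R53 (2) ∕
S4-R56 (2), CARD E «TJ-LOC», file (TL-c′-DATUM)): THE LOSS DATUM OF A BASE POINT — the letters `(γ, γ′, a)` with `T ≤ γ`, `T⁻¹ ≤ γ′`, `γ′·γ·αᵃ ≤ 1` for ANY `T ∈ GL_m(K)`
over a non-archimedean local field, their stability on a Cayley coset window, and the scaling letter `hLss` of the twisted linear part for ★ `exists_depth`.
Crux H413 `stmt-HodgeConjecture-24833`, lane `--supports … --as helper` (count-neutral).  THEOREMS ONLY (no `def`, no `instance`, no notation, no named-fact hypothesis, no `sorry`).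
-/
import Summits.HodgeConjecture.HodgeConjecture.Theorems.R90S4CayleyTwistedSlotLoss   -- ★ (TL-a) p864716 (this seat): `valBound_conj_of_valBound`; brings ★ C5∕C2 (`cayley`, `isUnit_det_one_{sub,add}_of_valBound`), ★ `ValBound`
import Mathlib.GroupTheory.ArchimedeanDensely                                        -- `exists_pow_lt₀`
import HarnessLib

/-!
# R90-TF · S4 (Ch. 13.1–2) · road (J̃♭) «TWISTED TUBE JACOBIAN», CARD E «TJ-LOC» file (TL-c′-DATUM): THE LOSS DATUM `(γ, γ′, a)` OF A BASE POINT `T = ρ(b₀) ∈ GL_m(K)`,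
# ITS STABILITY ON A CAYLEY COSET WINDOW, AND THE SCALING LETTER OF THE TWISTED LINEAR PART (torus- and group-agnostic; no measure)

Dealt by the S4 dealer K2E2-plan (g8) (S4-R53 (2) 2026-09-05T02:46:33Z, S4-R56 (2) 02:52:26Z: «torus-agnostic ⇒ `R90S4TwistedTubeDatum`»).  Seat K2E4-p11 (g10).
THE POINT.  The loss twins of the Cayley tube — ★ (TL-a) `R90S4CayleyTwistedSlotLoss` (this seat) and (TL-b′) `R90S4TwistedTubeCoreLoss` (K2E3-p36) — run the filtered Newton
scheme of ★ C8a at a base point `T = ρ(b₀)` that is NOT integral, under the three LETTERS `(hT : ValBound γ T) (hTinv : ValBound γ′ T⁻¹) (hloss : γ′ * γ * α ^ a ≤ 1)`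
and the depth `k₀` of ★ `F0P3cStCharTSJacCartanElliptic.exists_depth`.  This file DISCHARGES the letters for EVERY `T ∈ GL_m(K)` over a non-archimedean local field `K`
(§2 `exists_lossData`: finite sup of entry valuations + the archimedean value group, Mathlib `exists_pow_lt₀`), shows that ONE tuple `(γ, γ′, a)` serves the whole Cayley
coset window `T·c(Y)`, `Y` in any level (§3: `c(Y)`, `c(Y)⁻¹ = c(−Y)` are integral), and supplies the scaling letter `hLss : L⁻¹ (s Z) = s (L⁻¹ Z)` of ★ `exists_depth` for the
twisted linear part `ι(L Z) = T⁻¹ ι(pM Z) T + E ι(pM Z) + ι(pT Z)` whenever the slot `E` is `π`-linear (§4; at the datum `E = τ` is `σ`-semilinear and the level scalar `π` is an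
`L⁺_v`-uniformiser, fixed by `σ`).  Nothing here depends on a torus, a member type (split ∕ `K¹ × E¹` ∕ `(E¹)³` ∕ cubic), regularity, or a measure: at the datum one takes
`T := ρ b₀` for an ε-regular `b₀ ∈ T̃ = Cent(γ₀)` read in the one-place model `G̃_v ≃ GL₃(L_w)` (★ p864222 §3), and the projections `pM, pT` of ★ `isCompl_ker_range_adSubOne` at the
regular `N b₀` — [Rogawski1990, §12.5 p. 186] (twisted Weyl integration formula: the Jacobian at `δ` depends on `N δ` only; the hyperbolic member has unbounded base points).

## CONTENTS
* §1 `exists_entry_valBound` (every matrix has an entrywise bound), `exists_mul_pow_le_one_of_lt_one` (`∃ a, γ·αᵃ ≤ 1`, local field).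
* §2 **`exists_lossData`** — `∃ γ γ′ a, T ≤ γ ∧ T⁻¹ ≤ γ′ ∧ γ′·γ·αᵃ ≤ 1` for every `T : GL m K`; `exists_lossData_conj` (the conjugate bound (TL-b′) feeds ★ (TL-a) with).
* §3 window stability: `valBound_one_cayley`, `valBound_one_cayley_inv`, **`lossData_mul`**, `lossData_mul_left`.
* §4 scaling: `symm_comm_scaling`, **`twistedLinear_comm_scaling`** (`hLss` for ★ `exists_depth`).

HONEST LABEL: HC_CM is proved only modulo the 7 printed citations (2 remaining named inputs: hLiu418 = `stmt-HodgeConjecture-24832`, h413 = `stmt-HodgeConjecture-24833`)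
until rung 0 closes; this file closes no organ ((J̃♭) E∕M stay OPEN); count-neutral helper.

## References
* [Rogawski1990] J. Rogawski, *Automorphic Representations of Unitary Groups in Three Variables*, Ann. of Math. Stud. 123 (1990), §12.5 pp. 182, 186.
* [HarishChandra1970] Harish-Chandra (notes by G. van Dijk), *Harmonic Analysis on Reductive p-adic Groups*, LNM 162 (1970), Lemma 22.
* [Serre1992LALG] J.-P. Serre, *Lie Algebras and Lie Groups*, LNM 1500 (1992), Part II Ch. IV §8–§9.
* [PlatonovRapinchuk1994] V. Platonov, A. Rapinchuk, *Algebraic Groups and Number Theory* (1994), §3.3.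
-/

set_option autoImplicit false
set_option linter.dupNamespace false

open Matrix ValuativeRel Literature.NumberTheory.Automorphic
open Literature.NumberTheory.Weil1982.UnitaryFinTopForm
open scoped Matrix MatrixGroups

namespace Summit.HodgeConjecture.HodgeConjecture.R90.S4

/-! ## §1 Entrywise bounds exist; the value group of a local field absorbs any bound into a power of `α` -/

section Letters

variable {K : Type*} [Field K] [ValuativeRel K] {m : Type*} [Fintype m] [DecidableEq m]

omit [Fintype m] [DecidableEq m] in
/-- **Every matrix over a valued field has an entrywise bound** (`m` finite: the finitely many entry valuations are bounded above in the linearly ordered value group).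
[cite: Serre1992LALG, Part II Ch. IV §9] -/
theorem exists_entry_valBound [Finite m] (M : Matrix m m K) : ∃ γ : ValueGroupWithZero K, ValBound γ M := by
  obtain ⟨γ, hγ⟩ := (Set.finite_range (fun p : m × m => valuation K (M p.1 p.2))).bddAbove
  exact ⟨γ, fun i j => hγ ⟨(i, j), rfl⟩⟩

omit [Fintype m] [DecidableEq m] in
/-- **The value group of a non-archimedean local field absorbs any bound**: for `α < 1` and any `γ` there is `a : ℕ` with `γ·αᵃ ≤ 1` (Mathlib `exists_pow_lt₀` in the
multiplicatively archimedean value group; `γ = 0` is trivial).  This is the loss exponent `a = a(b₀)` of a non-integral base point. [cite: Serre1992LALG, Part II Ch. IV §9] -/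
theorem exists_mul_pow_le_one_of_lt_one [TopologicalSpace K] [IsNonarchimedeanLocalField K] {α : ValueGroupWithZero K} (hα1 : α < 1) (γ : ValueGroupWithZero K) :
    ∃ a : ℕ, γ * α ^ a ≤ 1 := by
  by_cases hγ : γ = 0
  · exact ⟨0, by rw [hγ, zero_mul]; exact zero_le_one⟩
  · obtain ⟨n, hn⟩ := exists_pow_lt₀ hα1 (Units.mk0 γ hγ)⁻¹
    refine ⟨n, ?_⟩
    have hinv : (((Units.mk0 γ hγ)⁻¹ : (ValueGroupWithZero K)ˣ) : ValueGroupWithZero K) = γ⁻¹ := by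
      rw [Units.val_inv_eq_inv_val, Units.val_mk0]
    have hle : α ^ n ≤ γ⁻¹ := hn.le.trans_eq hinv
    calc γ * α ^ n ≤ γ * γ⁻¹ := by gcongr
      _ = 1 := mul_inv_cancel₀ hγ

/-! ## §2 The loss datum of an invertible matrix -/

/-- **THE LOSS DATUM OF A BASE POINT**: for every `T ∈ GL_m(K)` over a non-archimedean local field and every level ratio `α < 1` there are `γ, γ′ ∈ Γ_K` and `a : ℕ` with
`T ≤ γ`, `T⁻¹ ≤ γ′` entrywise and `γ′·γ·αᵃ ≤ 1` — EXACTLY the letters `(hT) (hTinv) (hloss)` of (TL-b′) `R90S4TwistedTubeCoreLoss` at `T := ρ b₀`, for a base point `b₀` of ANY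
Cartan (no integrality: at the hyperbolic member of the twisted Weyl integration formula `b₀` is unbounded modulo `Z̃·(1−ε)T̃`, and `a > 0` is the price).
[cite: Rogawski1990, §12.5 p. 186] [cite: HarishChandra1970, Lemma 22] -/
theorem exists_lossData [TopologicalSpace K] [IsNonarchimedeanLocalField K] {α : ValueGroupWithZero K} (hα1 : α < 1) (g : GL m K) :
    ∃ (γ γ' : ValueGroupWithZero K) (a : ℕ),
      ValBound γ (g : Matrix m m K) ∧ ValBound γ' ((g⁻¹ : GL m K) : Matrix m m K) ∧ γ' * γ * α ^ a ≤ 1 := by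
  obtain ⟨γ, hγ⟩ := exists_entry_valBound (g : Matrix m m K)
  obtain ⟨γ', hγ'⟩ := exists_entry_valBound ((g⁻¹ : GL m K) : Matrix m m K)
  obtain ⟨a, ha⟩ := exists_mul_pow_le_one_of_lt_one hα1 (γ' * γ)
  exact ⟨γ, γ', a, hγ, hγ', ha⟩

omit [DecidableEq m] in
/-- **The conjugate bound the loss datum buys** (the form (TL-b′) feeds ★ (TL-a) with): `T ≤ γ`, `T⁻¹ ≤ γ′`, `γ′·γ·αᵃ ≤ 1`, `X ≤ α^(j + a + 1)` ⇒ `T⁻¹ X T ≤ α^(j + 1)` —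
conjugation by a non-integral base point costs at most `a` levels. [cite: Serre1992LALG, Part II Ch. IV §8] [cite: PlatonovRapinchuk1994, §3.3] -/
theorem exists_lossData_conj {α γ γ' : ValueGroupWithZero K} {a : ℕ} {T Tinv X : Matrix m m K} (hT : ValBound γ T) (hTinv : ValBound γ' Tinv)
    (hloss : γ' * γ * α ^ a ≤ 1) {j : ℕ} (hX : ValBound (α ^ (j + a + 1)) X) : ValBound (α ^ (j + 1)) (Tinv * X * T) := by
  refine valBound_conj_of_valBound_of_le hT hTinv hX ?_
  have e : γ' * α ^ (j + a + 1) * γ = γ' * γ * α ^ a * α ^ (j + 1) := by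
    rw [show j + a + 1 = a + (j + 1) by omega, pow_add]
    simp only [mul_assoc, mul_comm]
  calc γ' * α ^ (j + a + 1) * γ = γ' * γ * α ^ a * α ^ (j + 1) := e
    _ ≤ 1 * α ^ (j + 1) := by gcongr
    _ = α ^ (j + 1) := one_mul _

/-! ## §3 One loss datum serves a whole Cayley coset window -/

/-- `c(Y) = (1 + Y)(1 − Y)⁻¹` is INTEGRAL for `Y ≤ α < 1` (★ C2: `1 − Y` has an integral inverse). [cite: PlatonovRapinchuk1994, §3.3] -/
theorem valBound_one_cayley {α : ValueGroupWithZero K} {Y : Matrix m m K} (hY : ValBound α Y) (hα1 : α < 1) : ValBound 1 (cayley Y) := by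
  obtain ⟨-, hinv, -⟩ := isUnit_det_one_sub_of_valBound hY hα1
  have h1 : ValBound 1 (1 + Y) := valBound_one.add (hY.mono hα1.le)
  rw [cayley_def]
  simpa using h1.mul hinv

/-- `c(Y)⁻¹ = c(−Y)` is INTEGRAL for `Y ≤ α < 1`. [cite: PlatonovRapinchuk1994, §3.3] -/
theorem valBound_one_cayley_inv {α : ValueGroupWithZero K} {Y : Matrix m m K} (hY : ValBound α Y) (hα1 : α < 1) : ValBound 1 (cayley Y)⁻¹ := by
  obtain ⟨hm, -, -⟩ := isUnit_det_one_sub_of_valBound hY hα1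
  obtain ⟨hp, -, -⟩ := isUnit_det_one_add_of_valBound hY hα1
  rw [Matrix.inv_eq_left_inv (cayley_neg_mul_cayley hm hp)]
  exact valBound_one_cayley hY.neg hα1

omit [DecidableEq m] in
/-- **ONE LOSS DATUM SERVES THE WINDOW (right translates)**: if `g ≤ γ`, `g⁻¹ ≤ γ′` and `y`, `y⁻¹` are integral then `g·y ≤ γ` and `(g·y)⁻¹ = y⁻¹g⁻¹ ≤ γ′` — so on the Cayley
coset window `b₀ · c(Λ_j ∩ 𝔷)` (every `c(Y)`, `c(Y)⁻¹` integral, §3) the letters `(γ, γ′, a)` of `b₀` work for every base point; monotone-safe (no valuation of a single entry is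
ever computed). [cite: Rogawski1990, §12.5 p. 186] [cite: HarishChandra1970, Lemma 22] -/
theorem lossData_mul [DecidableEq m] {γ γ' : ValueGroupWithZero K} {g y : GL m K} (hg : ValBound γ (g : Matrix m m K)) (hg' : ValBound γ' ((g⁻¹ : GL m K) : Matrix m m K))
    (hy : ValBound 1 (y : Matrix m m K)) (hy' : ValBound 1 ((y⁻¹ : GL m K) : Matrix m m K)) :
    ValBound γ ((g * y : GL m K) : Matrix m m K) ∧ ValBound γ' (((g * y)⁻¹ : GL m K) : Matrix m m K) := by
  refine ⟨?_, ?_⟩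
  · rw [Units.val_mul]
    simpa using hg.mul hy
  · rw [_root_.mul_inv_rev, Units.val_mul]
    simpa using hy'.mul hg'

omit [DecidableEq m] in
/-- The same for left translates `y·g` (central ∕ left conventions). [cite: Rogawski1990, §12.5 p. 186] -/
theorem lossData_mul_left [DecidableEq m] {γ γ' : ValueGroupWithZero K} {g y : GL m K} (hg : ValBound γ (g : Matrix m m K)) (hg' : ValBound γ' ((g⁻¹ : GL m K) : Matrix m m K))
    (hy : ValBound 1 (y : Matrix m m K)) (hy' : ValBound 1 ((y⁻¹ : GL m K) : Matrix m m K)) :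
    ValBound γ ((y * g : GL m K) : Matrix m m K) ∧ ValBound γ' (((y * g)⁻¹ : GL m K) : Matrix m m K) := by
  refine ⟨?_, ?_⟩
  · rw [Units.val_mul]
    simpa using hy.mul hg
  · rw [_root_.mul_inv_rev, Units.val_mul]
    simpa using hg'.mul hy'

/-- **The window form at a chart point**: for `u ∈ GL_m(K)` read in the chart as `u = c(Y)` with `Y ≤ α < 1`, the letters of `g` are letters of `g·u`.
[cite: HarishChandra1970, Lemma 22] [cite: PlatonovRapinchuk1994, §3.3] -/
theorem lossData_mul_of_eq_cayley {α γ γ' : ValueGroupWithZero K} {g u : GL m K} {Y : Matrix m m K} (hg : ValBound γ (g : Matrix m m K))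
    (hg' : ValBound γ' ((g⁻¹ : GL m K) : Matrix m m K)) (hu : (u : Matrix m m K) = cayley Y) (hY : ValBound α Y) (hα1 : α < 1) :
    ValBound γ ((g * u : GL m K) : Matrix m m K) ∧ ValBound γ' (((g * u)⁻¹ : GL m K) : Matrix m m K) := by
  refine lossData_mul hg hg' (hu ▸ valBound_one_cayley hY hα1) ?_
  rw [Matrix.coe_units_inv, hu]
  exact valBound_one_cayley_inv hY hα1

end Letters

/-! ## §4 The scaling letter `hLss` of the twisted linear part for ★ `exists_depth` -/

section Scaling

variable {K : Type*} [Field K] {m : Type*} [Fintype m] {V : Type*} [AddCommGroup V] [TopologicalSpace V]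

omit [TopologicalSpace V] in
/-- If an additive automorphism commutes with the scaling `s` then so does its inverse. [cite: Serre1992LALG, Part II Ch. IV §9] -/
theorem symm_comm_scaling' (L s : V ≃+ V) (h : ∀ Z, L (s Z) = s (L Z)) : ∀ Z, L.symm (s Z) = s (L.symm Z) := by
  intro Z
  apply L.injective
  rw [L.apply_symm_apply, h, L.apply_symm_apply]

/-- The same for a topological additive automorphism `L : V ≃ₜ+ V` (the shape ★ `exists_depth` takes: `hLss : ∀ Z, L.symm (s Z) = s (L.symm Z)`).
[cite: Serre1992LALG, Part II Ch. IV §9] -/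
theorem symm_comm_scaling (L : V ≃ₜ+ V) (s : V ≃+ V) (h : ∀ Z, L (s Z) = s (L Z)) : ∀ Z, L.symm (s Z) = s (L.symm Z) := by
  intro Z
  apply L.injective
  rw [L.apply_symm_apply, h, L.apply_symm_apply]

/-- **THE TWISTED LINEAR PART COMMUTES WITH THE SCALING**: if `ι (L Z) = T⁻¹ ι(pM Z) T + E (ι (pM Z)) + ι(pT Z)` with `ι` injective, `ι (s Z) = π • ι Z`, `pM, pT`
commuting with `s`, and the slot `E` `π`-LINEAR (`E (π • W) = π • E W` — at the datum `E = τ` is `σ`-semilinear and the level scalar `π ∈ L⁺_v` is `σ`-fixed), then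
`L (s Z) = s (L Z)`; hence `hLss` by `symm_comm_scaling`.  This is the one hypothesis of ★ `F0P3cStCharTSJacCartanElliptic.exists_depth` that is specific to the twisted
road; the base point `T` is arbitrary (no integrality). [cite: Rogawski1990, §12.5 p. 186] [cite: Serre1992LALG, Part II Ch. IV §9] -/
theorem twistedLinear_comm_scaling (ι : V →+ Matrix m m K) (hinj : Function.Injective ι) (s : V ≃+ V) {π : K} (hsι : ∀ Z, ι (s Z) = π • ι Z)
    (pM pT : V →+ V) (hpMs : ∀ Z, pM (s Z) = s (pM Z)) (hpTs : ∀ Z, pT (s Z) = s (pT Z))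
    (E : Matrix m m K →+ Matrix m m K) (hEπ : ∀ W, E (π • W) = π • E W) (L : V ≃ₜ+ V) {T Tinv : Matrix m m K}
    (hL : ∀ Z, ι (L Z) = Tinv * ι (pM Z) * T + E (ι (pM Z)) + ι (pT Z)) : ∀ Z, L (s Z) = s (L Z) := by
  intro Z
  apply hinj
  rw [hL, hpMs, hpTs, hsι, hsι, hEπ, hsι (L Z), hL, smul_add, smul_add, Matrix.mul_smul, Matrix.smul_mul]

/-- `hLss` for the twisted linear part, packaged. [cite: Rogawski1990, §12.5 p. 186] [cite: Serre1992LALG, Part II Ch. IV §9] -/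
theorem twistedLinear_symm_comm_scaling (ι : V →+ Matrix m m K) (hinj : Function.Injective ι) (s : V ≃+ V) {π : K} (hsι : ∀ Z, ι (s Z) = π • ι Z)
    (pM pT : V →+ V) (hpMs : ∀ Z, pM (s Z) = s (pM Z)) (hpTs : ∀ Z, pT (s Z) = s (pT Z))
    (E : Matrix m m K →+ Matrix m m K) (hEπ : ∀ W, E (π • W) = π • E W) (L : V ≃ₜ+ V) {T Tinv : Matrix m m K}
    (hL : ∀ Z, ι (L Z) = Tinv * ι (pM Z) * T + E (ι (pM Z)) + ι (pT Z)) : ∀ Z, L.symm (s Z) = s (L.symm Z) :=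
  symm_comm_scaling L s (twistedLinear_comm_scaling ι hinj s hsι pM pT hpMs hpTs E hEπ L hL)

end Scaling

end Summit.HodgeConjecture.HodgeConjecture.R90.S4
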